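import Literature.Computability.Learning.NWPredictorFP
import Literature.Computability.Learning.AmpEvalFP
import HarnessLib

/-!
# The Goldreich–Levin stage of the hypothesis in `FP`

Machine-layer instalment (M5) of the decomposition of the named fact
`Literature.Computability.Learning.cikk_natural_implies_learning` (CIKK 2016, Thm. 5.1): Rackoff's
Goldreich–Levin candidate `glCandidate B kk s σ` (`GoldreichLevin.lean`) for the oracle
`B(r) = C₂(x⃗, r)` given by a predictor for `AMP(f)` (`glOracle`, `glStage` of
`NaturalLearningRun.lean`), as string functions. The predictor is an arbitrary string function
`pred` with `pred ⟨P, u⟩ = [h₁ u]` (a parameter; the learner uses `predFn dR`). On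
`⟨G, xsbits⟩`, `G = ⟨P, ⟨⟨1ⁿ, ⟨1ᵏ, 1^kk⟩⟩, ⟨sdbits, σbits⟩⟩⟩` (`sdbits` the `kk` seeds of `k`
bits each, `σbits` the `kk` guess bits, `xsbits` the tuple `x⃗` as `kn` bits):

* `xorStrFn ⟨a, b⟩` (bitwise xor), `seedSumFn` (the combined query `r_T = ⊕_{t ∈ T} sᵗ` for the
  subset `T_μ = {t | μ_t}` given by mask bits), `unitFlipFn` (`r ↦ r ⊕ e_c`);
* `voteFn` (Rackoff's vote `σ_T + B(r_T + e_c)`), `countFn` (the number of nonempty `T` voting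
  `1`), `candBitFn` (the majority bit), `candVecFn` (the `k` candidate bits);
* bridge: `candVecFn_apply`: on genuine records the value is
  `List.ofFn (glStage h₁ (sd, σ) xs)`.

## References

* M. Carmosino, R. Impagliazzo, V. Kabanets, A. Kolokolova, *Learning algorithms from natural
  proofs*, CCC 2016, Thm. 4.2 and Claim 4.4 [CarmosinoImpagliazzoKabanetsKolokolova2016].
* S. Arora, B. Barak, *Computational Complexity: A Modern Approach*, CUP 2009, Thm. 9.12 (proof)
  [AroraBarakCC2009].
-/

open Polynomial

namespace Literature.Computability.Learning

open Literature.Computability.Complexity Literature.Computability.Complexity.Brick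
  Literature.Computability.Complexity.Plumb Literature.Computability.MetaComplexity
  Literature.Computability.Cryptography _root_.Computability Matrix Finset

/-! ### Bitwise xor of strings -/

/-- The piece of the xor fold on `⟨⟨a, b⟩, 1ᵖ⟩`: `[a_p ⊕ b_p]`. [folklore] -/
noncomputable def xorPiece : List Bool → List Bool :=
  HashBricks.xorFn (HashBricks.headBitFn ∘ bitAtFn ∘ fanoutFn sndF (fstF ∘ fstF))
    (HashBricks.headBitFn ∘ bitAtFn ∘ fanoutFn sndF (sndF ∘ fstF))

/-- `xorPiece ∈ FP`. [folklore] -/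
theorem xorPiece_mem_FP : xorPiece ∈ FP :=
  HashBricks.xorFn_mem_FP
    (comp_mem_FP HashBricks.headBitFn_mem_FP (comp_mem_FP bitAtFn_mem_FP
      (fanoutFn_mem_FP sndF_mem_FP (comp_mem_FP fstF_mem_FP fstF_mem_FP))))
    (comp_mem_FP HashBricks.headBitFn_mem_FP (comp_mem_FP bitAtFn_mem_FP
      (fanoutFn_mem_FP sndF_mem_FP (comp_mem_FP sndF_mem_FP fstF_mem_FP))))

/-- Value of `xorPiece` (total in the context `w`, read through `fstF`/`sndF`). [folklore] -/
theorem xorPiece_apply (w : List Bool) (p : ℕ) :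
    xorPiece (boolPair w (ones p)) = [xor (((fstF w).drop p).headD false) (((sndF w).drop p).headD false)] := by
  rw [xorPiece, HashBricks.xorFn_apply (b := ((fstF w).drop p).headD false) (b' := ((sndF w).drop p).headD false)]
  · simp only [Function.comp_apply, fanoutFn_apply, sndF_boolPair, fstF_boolPair, bitAtFn_boolPair,
      HashBricks.headBitFn_apply, List.length_replicate, ones]
    cases (fstF w).drop p <;> simp
  · simp only [Function.comp_apply, fanoutFn_apply, sndF_boolPair, fstF_boolPair, bitAtFn_boolPair,
      HashBricks.headBitFn_apply, List.length_replicate, ones]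
    cases (sndF w).drop p <;> simp

/-- `xorPiece` is one-bit. [folklore] -/
theorem oneBit_xorPiece : OneBit xorPiece :=
  HashBricks.oneBit_xorFn (HashBricks.oneBit_headBitFn.comp _) (HashBricks.oneBit_headBitFn.comp _)

/-- **Bitwise xor** `⟨a, b⟩ ↦ (a_p ⊕ b_p)_{p < |a|}`. [folklore] -/
noncomputable def xorStrFn : List Bool → List Bool :=
  sndPow 2 ∘ foldLoop appF (clipF 1 xorPiece) X ∘
    fanoutFn id (fanoutFn (lenBinF ∘ fstF) (fun _ => boolPair [] []))

/-- `xorStrFn ∈ FP`. [folklore] -/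
theorem xorStrFn_mem_FP : xorStrFn ∈ FP :=
  comp_mem_FP (sndPow_mem_FP 2) (comp_mem_FP
    (foldLoop_clipF_mem_FP 1 appF_mem_FP length_appF_le xorPiece_mem_FP X)
    (fanoutFn_mem_FP (PolyTimeComputable.id _)
      (fanoutFn_mem_FP (comp_mem_FP lenBinF_mem_FP fstF_mem_FP) (const_mem_FP _))))

/-- Value of `xorStrFn` on every input. [folklore] -/
theorem xorStrFn_apply (w : List Bool) :
    xorStrFn w = ccat (fun p => [xor (((fstF w).drop p).headD false) (((sndF w).drop p).headD false)]) (fstF w).length := by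
  have hn : (fstF w).length ≤ X.eval w.length := by
    rw [eval_X]; have := length_fstF_sndF_le w; omega
  rw [xorStrFn, Function.comp_apply, Function.comp_apply, fanoutFn_apply, fanoutFn_apply, id,
    Function.comp_apply, lenBinF_apply,
    show (boolPair ([] : List Bool) []) = boolPair (ones 0) ([] : List Bool) by rfl,
    foldLoop_apply _ _ hn, foldAcc_clipF (fun j _ _ => by rw [(oneBit_xorPiece).length_eq]; omega), foldAcc_appF]
  simp [sndPow, xorPiece_apply]

/-- The output of `xorStrFn` is as long as the first field, on every input. [folklore] -/
theorem length_xorStrFn (w : List Bool) : (xorStrFn w).length = (fstF w).length := by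
  rw [xorStrFn_apply]
  generalize (fstF w).length = m
  induction m with
  | zero => rfl
  | succ m ih => rw [ccat_succ, List.length_append, ih]; rfl

/-- Value of `xorStrFn` on genuine vectors. [folklore] -/
theorem xorStrFn_ofFn {m : ℕ} (a b : Fin m → Bool) :
    xorStrFn (boolPair (List.ofFn a) (List.ofFn b)) = List.ofFn fun p => xor (a p) (b p) := by
  rw [xorStrFn_apply, fstF_boolPair, sndF_boolPair, List.length_ofFn,
    ccat_congr (g' := fun p => [if h : p < m then xor (a ⟨p, h⟩) (b ⟨p, h⟩) else false])
    (fun p hp => by rw [headD_drop_ofFn a hp, headD_drop_ofFn b hp, dif_pos hp]), ccat_singleton_eq_ofFn]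
  exact congrArg List.ofFn (funext fun p => by rw [dif_pos p.isLt])

/-- Xor with zeros is the identity on genuine vectors. [folklore] -/
theorem xorStrFn_ofFn_replicate {m : ℕ} (a : Fin m → Bool) :
    xorStrFn (boolPair (List.ofFn a) (List.replicate m false)) = List.ofFn a := by
  rw [show List.replicate m false = List.ofFn (fun _ : Fin m => false) by simp [List.ofFn_const], xorStrFn_ofFn]
  simp

/-! ### The combined query `r_T = ⊕_{t ∈ T} sᵗ` and the flip `r ⊕ e_c` -/

/-- The seeds `s⁰, …, s^{kk-1} ∈ 𝔽₂^k` as one string of `kk·k` bits (seed `t` = bits `[tk, tk+k)`).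
[folklore] -/
def seedBits {k kk : ℕ} (sd : Fin kk → BVec k) : List Bool :=
  List.ofFn fun idx : Fin (kk * k) => zmodToBool (sd (finProdFinEquiv.symm idx).1 (finProdFinEquiv.symm idx).2)

/-- Block `t` of `seedBits` is seed `t`. [folklore] -/
theorem drop_take_seedBits {k kk : ℕ} (sd : Fin kk → BVec k) (t : Fin kk) :
    ((seedBits sd).drop (t * k)).take k = List.ofFn fun p : Fin k => zmodToBool (sd t p) := by
  apply List.ext_getElem
  · simp only [List.length_take, List.length_drop, seedBits, List.length_ofFn]
    have h1 : (t : ℕ) + 1 ≤ kk := t.isLt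
    have : (t + 1) * k ≤ kk * k := Nat.mul_le_mul_right k h1
    rw [add_mul, one_mul] at this
    omega
  · intro p h1 h2
    rw [List.length_ofFn] at h2
    simp only [seedBits, List.getElem_take, List.getElem_drop, List.getElem_ofFn]
    have hidx : (finProdFinEquiv.symm (⟨t * k + p, by
        have h1 : (t : ℕ) + 1 ≤ kk := t.isLt
        have : (t + 1) * k ≤ kk * k := Nat.mul_le_mul_right k h1
        rw [add_mul, one_mul] at this; omega⟩ : Fin (kk * k))) = (t, ⟨p, h2⟩) := by
      rw [Equiv.symm_apply_eq]
      apply Fin.ext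
      simp [finProdFinEquiv]
      ring
    rw [hidx]

/-- The piece of the seed-sum fold on `⟨⟨⟨⟨1ᵏ, 1^kk⟩, sdbits⟩, μbits⟩, 1ᵗ⟩`: seed `t` if `μ_t`, else
`0ᵏ`. [folklore] -/
noncomputable def seedPiece : List Bool → List Bool :=
  iteFn (HashBricks.headBitFn ∘ bitAtFn ∘ fanoutFn sndF (sndF ∘ fstF))
    (takeFn ∘ fanoutFn (fstF ∘ fstF ∘ fstF ∘ fstF)
      (dropFn ∘ fanoutFn (HashBricks.umulFn ∘ fanoutFn sndF (fstF ∘ fstF ∘ fstF ∘ fstF)) (sndF ∘ fstF ∘ fstF)))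
    (Kannan.zerosFn ∘ fstF ∘ fstF ∘ fstF ∘ fstF)

/-- `seedPiece ∈ FP`. [folklore] -/
theorem seedPiece_mem_FP : seedPiece ∈ FP := by
  have h4 : (fstF ∘ fstF ∘ fstF ∘ fstF : List Bool → List Bool) ∈ FP :=
    comp_mem_FP fstF_mem_FP (comp_mem_FP fstF_mem_FP (comp_mem_FP fstF_mem_FP fstF_mem_FP))
  exact iteFn_mem_FP
    (comp_mem_FP HashBricks.headBitFn_mem_FP (comp_mem_FP bitAtFn_mem_FP
      (fanoutFn_mem_FP sndF_mem_FP (comp_mem_FP sndF_mem_FP fstF_mem_FP))))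
    (comp_mem_FP takeFn_mem_FP (fanoutFn_mem_FP h4 (comp_mem_FP dropFn_mem_FP
      (fanoutFn_mem_FP (comp_mem_FP HashBricks.umulFn_mem_FP (fanoutFn_mem_FP sndF_mem_FP h4))
        (comp_mem_FP sndF_mem_FP (comp_mem_FP fstF_mem_FP fstF_mem_FP))))))
    (comp_mem_FP Kannan.zerosFn_mem_FP h4)

/-- Value of `seedPiece`. [folklore] -/
theorem seedPiece_apply (k kk : ℕ) (sdbits μbits : List Bool) (t : ℕ) :
    seedPiece (boolPair (boolPair (boolPair (boolPair (ones k) (ones kk)) sdbits) μbits) (ones t)) =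
      if (μbits.drop t).headD false then (sdbits.drop (t * k)).take k else List.replicate k false := by
  rw [seedPiece, iteFn_apply (b := (μbits.drop t).headD false) (by
    simp only [Function.comp_apply, fanoutFn_apply, sndF_boolPair, fstF_boolPair, bitAtFn_boolPair,
      HashBricks.headBitFn_apply, List.length_replicate, ones]
    cases μbits.drop t <;> simp)]
  split_ifs <;> simp [ones]

/-- The seed pieces have length `≤ k ≤ |context|`. [folklore] -/
theorem length_seedPiece_apply_le (k kk : ℕ) (sdbits μbits : List Bool) (t : ℕ) :
    (seedPiece (boolPair (boolPair (boolPair (boolPair (ones k) (ones kk)) sdbits) μbits) (ones t))).length ≤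
      1 * ((boolPair (boolPair (boolPair (ones k) (ones kk)) sdbits) μbits).length + 1) := by
  rw [seedPiece_apply]
  have hk : k ≤ (boolPair (boolPair (boolPair (ones k) (ones kk)) sdbits) μbits).length := by
    simp only [length_boolPair, ones, List.length_replicate]; omega
  split_ifs
  · exact (List.length_take_le _ _).trans (by omega)
  · simp; omega

/-- **The combined query** `r_T` on `⟨⟨⟨1ᵏ, 1^kk⟩, sdbits⟩, μbits⟩`: the xor of the seeds `sᵗ` with
`μ_t = 1` (a xor fold from `0ᵏ`). [cite: AroraBarakCC2009, Thm. 9.12 (proof: "`r^j = Σ_{t ∈ T_j} s^t`")] -/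
noncomputable def seedSumFn : List Bool → List Bool :=
  sndPow 2 ∘ foldLoop xorStrFn (clipF 1 seedPiece) X ∘
    fanoutFn id (fanoutFn (lenBinF ∘ sndF ∘ fstF ∘ fstF)
      (fanoutFn (fun _ => []) (Kannan.zerosFn ∘ fstF ∘ fstF ∘ fstF)))

/-- `seedSumFn ∈ FP`. [folklore] -/
theorem seedSumFn_mem_FP : seedSumFn ∈ FP :=
  comp_mem_FP (sndPow_mem_FP 2) (comp_mem_FP
    (foldLoop_clipF_mem_FP (d := 0) 1 xorStrFn_mem_FP (fun w => by rw [length_xorStrFn]; omega) seedPiece_mem_FP X)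
    (fanoutFn_mem_FP (PolyTimeComputable.id _)
      (fanoutFn_mem_FP (comp_mem_FP lenBinF_mem_FP (comp_mem_FP sndF_mem_FP (comp_mem_FP fstF_mem_FP fstF_mem_FP)))
        (fanoutFn_mem_FP (const_mem_FP _) (comp_mem_FP Kannan.zerosFn_mem_FP
          (comp_mem_FP fstF_mem_FP (comp_mem_FP fstF_mem_FP fstF_mem_FP)))))))

/-- `𝔽₂` addition is xor. [folklore] -/
theorem zmodToBool_add (a b : ZMod 2) : zmodToBool (a + b) = xor (zmodToBool a) (zmodToBool b) := by
  fin_cases a <;> fin_cases b <;> decide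

/-- `zmodToBool 0 = false`. [folklore] -/
@[simp] theorem zmodToBool_zero : zmodToBool 0 = false := by decide

/-- The seed-sum context `⟨⟨⟨1ᵏ, 1^kk⟩, sdbits⟩, μbits⟩`. [folklore] -/
def seedCtx (k kk : ℕ) (sdbits μbits : List Bool) : List Bool :=
  boolPair (boolPair (boolPair (ones k) (ones kk)) sdbits) μbits

/-- The seed-sum fold after `r ≤ kk` rounds holds the partial sum. [folklore] -/
theorem foldAcc_seedPiece {k kk : ℕ} (sd : Fin kk → BVec k) (μ : Fin kk → Bool) :
    ∀ (r : ℕ), r ≤ kk →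
      foldAcc xorStrFn seedPiece (seedCtx k kk (seedBits sd) (List.ofFn μ)) 0 r (List.replicate k false) =
        List.ofFn fun p : Fin k => zmodToBool (∑ t : Fin kk, if (t : ℕ) < r ∧ μ t then sd t p else 0)
  | 0, _ => by simp [List.ofFn_const]
  | r + 1, hr => by
    have hrlt : r < kk := by omega
    rw [foldAcc_succ', foldAcc_seedPiece sd μ r (by omega)]
    have hp : seedPiece (boolPair (seedCtx k kk (seedBits sd) (List.ofFn μ)) (ones (0 + r))) =
        List.ofFn fun p : Fin k => zmodToBool (if μ ⟨r, hrlt⟩ then sd ⟨r, hrlt⟩ p else 0) := by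
      rw [Nat.zero_add, seedCtx, seedPiece_apply, headD_drop_ofFn μ hrlt, drop_take_seedBits sd ⟨r, hrlt⟩]
      cases μ ⟨r, hrlt⟩ <;> simp [List.ofFn_const]
    rw [hp, xorStrFn_ofFn]
    refine congrArg List.ofFn (funext fun p => ?_)
    rw [← zmodToBool_add]
    congr 1
    rw [show (if μ ⟨r, hrlt⟩ = true then sd ⟨r, hrlt⟩ p else 0) =
        ∑ t : Fin kk, if t = ⟨r, hrlt⟩ then (if μ t = true then sd t p else 0) else 0 by
        rw [Finset.sum_ite_eq']; simp,
      ← Finset.sum_add_distrib]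
    refine Finset.sum_congr rfl fun t _ => ?_
    by_cases ht : (t : ℕ) < r
    · have hne : t ≠ ⟨r, hrlt⟩ := fun h => by rw [h] at ht; exact lt_irrefl _ ht
      simp [ht, hne, show (t : ℕ) < r + 1 by omega]
    · by_cases hte : t = ⟨r, hrlt⟩
      · subst hte
        simp
      · have hte' : (t : ℕ) ≠ r := fun h => hte (Fin.ext h)
        simp [ht, hte, show ¬ ((t : ℕ) < r + 1) by omega]

/-- **Value of `seedSumFn`** on genuine seeds and mask: the bits of `Σ_{t : μ t} sᵗ`.
[cite: AroraBarakCC2009, Thm. 9.12 (proof)] -/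
theorem seedSumFn_apply {k kk : ℕ} (sd : Fin kk → BVec k) (μ : Fin kk → Bool) :
    seedSumFn (seedCtx k kk (seedBits sd) (List.ofFn μ)) =
      List.ofFn fun p : Fin k => zmodToBool (∑ t : Fin kk, if μ t then sd t p else 0) := by
  have hkk : kk ≤ X.eval (seedCtx k kk (seedBits sd) (List.ofFn μ)).length := by
    rw [eval_X, seedCtx]; simp only [length_boolPair, ones, List.length_replicate]; omega
  have h1 : lenBinF (sndF (fstF (fstF (seedCtx k kk (seedBits sd) (List.ofFn μ))))) = encodeNat kk := by
    simp [seedCtx, ones]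
  have h2 : Kannan.zerosFn (fstF (fstF (fstF (seedCtx k kk (seedBits sd) (List.ofFn μ))))) = List.replicate k false := by
    simp [seedCtx, ones]
  rw [seedSumFn, Function.comp_apply, Function.comp_apply, fanoutFn_apply, fanoutFn_apply, fanoutFn_apply, id,
    Function.comp_apply, Function.comp_apply, Function.comp_apply, h1,
    Function.comp_apply, Function.comp_apply, Function.comp_apply, h2,
    show ([] : List Bool) = ones 0 from rfl, foldLoop_apply _ _ hkk,
    foldAcc_clipF (fun j _ _ => by rw [seedCtx]; exact length_seedPiece_apply_le k kk _ _ j),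
    foldAcc_seedPiece sd μ kk le_rfl]
  rw [show sndPow 2 (boolPair (seedCtx k kk (seedBits sd) (List.ofFn μ)) (boolPair [] (boolPair (ones (0 + kk))
      (List.ofFn fun p : Fin k => zmodToBool (∑ t : Fin kk, if (t : ℕ) < kk ∧ μ t then sd t p else 0))))) =
      List.ofFn fun p : Fin k => zmodToBool (∑ t : Fin kk, if (t : ℕ) < kk ∧ μ t then sd t p else 0) by
    simp only [sndPow, Function.comp_apply, sndF_boolPair]]
  refine congrArg List.ofFn (funext fun p => congrArg zmodToBool (Finset.sum_congr rfl fun t _ => ?_))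
  simp only [t.isLt, true_and]

/-- **The flip `r ↦ r ⊕ e_c`** on `⟨⟨1ᵏ, 1ᶜ⟩, rbits⟩` (xor with the unit string `0ᶜ 1 0^{k-c-1}`).
[cite: AroraBarakCC2009, Thm. 9.12 (proof: the queries `r ⊕ eⁱ`)] -/
noncomputable def unitFlipFn : List Bool → List Bool :=
  xorStrFn ∘ fanoutFn sndF
    (appF ∘ fanoutFn (Kannan.zerosFn ∘ sndF ∘ fstF)
      (List.cons true ∘ Kannan.zerosFn ∘ dropFn ∘ fanoutFn (List.cons true ∘ sndF ∘ fstF) (fstF ∘ fstF)))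

/-- `unitFlipFn ∈ FP`. [folklore] -/
theorem unitFlipFn_mem_FP : unitFlipFn ∈ FP :=
  comp_mem_FP xorStrFn_mem_FP (fanoutFn_mem_FP sndF_mem_FP
    (comp_mem_FP appF_mem_FP (fanoutFn_mem_FP (comp_mem_FP Kannan.zerosFn_mem_FP (comp_mem_FP sndF_mem_FP fstF_mem_FP))
      (comp_mem_FP (cons_mem_FP true) (comp_mem_FP Kannan.zerosFn_mem_FP (comp_mem_FP dropFn_mem_FP
        (fanoutFn_mem_FP (comp_mem_FP (cons_mem_FP true) (comp_mem_FP sndF_mem_FP fstF_mem_FP))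
          (comp_mem_FP fstF_mem_FP fstF_mem_FP))))))))

/-- The unit string `0ᶜ 1 0^{k-c-1}` is `List.ofFn [p = c]` for `c < k`. [folklore] -/
theorem unitString_eq {k c : ℕ} (hc : c < k) :
    List.replicate c false ++ true :: List.replicate (k - (c + 1)) false =
      List.ofFn fun p : Fin k => decide ((p : ℕ) = c) := by
  apply List.ext_getElem
  · simp; omega
  · intro p h1 h2
    rw [List.length_ofFn] at h2
    rw [List.getElem_ofFn]
    dsimp only
    by_cases hpc : p < c
    · rw [List.getElem_append_left (by simpa using hpc), List.getElem_replicate]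
      exact (decide_eq_false (by omega)).symm
    · rw [List.getElem_append_right (by simpa using not_lt.1 hpc)]
      simp only [List.length_replicate]
      rcases Nat.eq_or_lt_of_le (not_lt.1 hpc) with h' | h'
      · subst h'; simp
      · obtain ⟨d, hd⟩ := Nat.exists_eq_succ_of_ne_zero (by omega : p - c ≠ 0)
        simp only [hd, List.getElem_cons_succ, List.getElem_replicate]
        exact (decide_eq_false (by omega)).symm

/-- **Value of `unitFlipFn`** on a genuine vector (`c < k`): the bits of `r + e_c`. [folklore] -/
theorem unitFlipFn_apply {k c : ℕ} (hc : c < k) (r : Fin k → Bool) :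
    unitFlipFn (boolPair (boolPair (ones k) (ones c)) (List.ofFn r)) =
      List.ofFn fun p : Fin k => xor (r p) (decide ((p : ℕ) = c)) := by
  rw [unitFlipFn, Function.comp_apply, fanoutFn_apply]
  simp only [Function.comp_apply, fanoutFn_apply, sndF_boolPair, fstF_boolPair, Kannan.zerosFn_apply,
    List.length_replicate, ones, dropFn_boolPair, List.length_cons, List.drop_replicate, appF_boolPair]
  rw [unitString_eq hc, xorStrFn_ofFn]

/-! ### Votes, counts, candidate bits -/

/-- The GL record `G = ⟨P, ⟨⟨1ⁿ, ⟨1ᵏ, ⟨1^kk, 1^{2^kk}⟩⟩⟩, ⟨sdbits, σbits⟩⟩⟩` (`1^{2^kk}` pads the number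
of subsets for the count loop). [folklore] -/
def glRec (P : List Bool) (n k kk : ℕ) (sdbits σbits : List Bool) : List Bool :=
  boolPair P (boolPair (boolPair (ones n) (boolPair (ones k) (boolPair (ones kk) (ones (2 ^ kk)))))
    (boolPair sdbits σbits))

section VoteAccessors
/-- Accessor on the vote argument `v = ⟨⟨G, xs⟩, ⟨1ᶜ, μ⟩⟩`: `G`. [folklore] -/
noncomputable def vG : List Bool → List Bool := fstF ∘ fstF
/-- Accessor: the dimension record of `G`. [folklore] -/
noncomputable def vDims : List Bool → List Bool := fstF ∘ sndF ∘ vG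
/-- The vote accessors are in `FP`. [folklore] -/
theorem vG_mem_FP : vG ∈ FP ∧ vDims ∈ FP :=
  ⟨comp_mem_FP fstF_mem_FP fstF_mem_FP,
    comp_mem_FP fstF_mem_FP (comp_mem_FP sndF_mem_FP (comp_mem_FP fstF_mem_FP fstF_mem_FP))⟩
end VoteAccessors

/-- **Rackoff's vote** `σ_T + B(r_T + e_c)` on `⟨⟨G, xsbits⟩, ⟨1ᶜ, μbits⟩⟩`, the oracle `B(r) = pred ⟨P, xs r⟩`.
[cite: AroraBarakCC2009, Thm. 9.12 (proof, Algorithm B′)] -/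
noncomputable def voteFn (pred : List Bool → List Bool) : List Bool → List Bool :=
  HashBricks.xorFn
    (HashBricks.headBitFn ∘ pred ∘ fanoutFn (fstF ∘ vG)
      (appF ∘ fanoutFn (sndF ∘ fstF)
        (unitFlipFn ∘ fanoutFn (fanoutFn (nthF 1 ∘ vDims) (fstF ∘ sndF))
          (seedSumFn ∘ fanoutFn (fanoutFn (fanoutFn (nthF 1 ∘ vDims) (nthF 2 ∘ vDims)) (fstF ∘ sndF ∘ sndF ∘ vG))
            (sndF ∘ sndF)))))
    (HashBricks.andParityFn ∘ fanoutFn (sndF ∘ sndF ∘ sndF ∘ vG) (sndF ∘ sndF))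

/-- `voteFn pred ∈ FP` for `pred ∈ FP`. [folklore] -/
theorem voteFn_mem_FP {pred : List Bool → List Bool} (hp : pred ∈ FP) : voteFn pred ∈ FP := by
  obtain ⟨hG, hD⟩ := vG_mem_FP
  refine HashBricks.xorFn_mem_FP ?_ (comp_mem_FP HashBricks.andParityFn_mem_FP (fanoutFn_mem_FP
    (comp_mem_FP sndF_mem_FP (comp_mem_FP sndF_mem_FP (comp_mem_FP sndF_mem_FP hG))) (comp_mem_FP sndF_mem_FP sndF_mem_FP)))
  exact comp_mem_FP HashBricks.headBitFn_mem_FP (comp_mem_FP hp (fanoutFn_mem_FP (comp_mem_FP fstF_mem_FP hG)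
    (comp_mem_FP appF_mem_FP (fanoutFn_mem_FP (comp_mem_FP sndF_mem_FP fstF_mem_FP)
      (comp_mem_FP unitFlipFn_mem_FP (fanoutFn_mem_FP (fanoutFn_mem_FP (comp_mem_FP (nthF_mem_FP 1) hD)
        (comp_mem_FP fstF_mem_FP sndF_mem_FP))
        (comp_mem_FP seedSumFn_mem_FP (fanoutFn_mem_FP
          (fanoutFn_mem_FP (fanoutFn_mem_FP (comp_mem_FP (nthF_mem_FP 1) hD) (comp_mem_FP (nthF_mem_FP 2) hD))
            (comp_mem_FP fstF_mem_FP (comp_mem_FP sndF_mem_FP (comp_mem_FP sndF_mem_FP hG))))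
          (comp_mem_FP sndF_mem_FP sndF_mem_FP)))))))))

/-- `voteFn pred` is one-bit. [folklore] -/
theorem oneBit_voteFn (pred : List Bool → List Bool) : OneBit (voteFn pred) :=
  HashBricks.oneBit_xorFn (HashBricks.oneBit_headBitFn.comp _) fun w => by
    rw [Function.comp_apply, fanoutFn_apply, HashBricks.andParityFn_boolPair]; exact ⟨_, rfl⟩

/-- **Value of `voteFn`** (string level). [folklore] -/
theorem voteFn_apply (pred : List Bool → List Bool) (P : List Bool) (n k kk : ℕ) (sdbits σbits xsbits μbits : List Bool) (c : ℕ) :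
    voteFn pred (boolPair (boolPair (glRec P n k kk sdbits σbits) xsbits) (boolPair (ones c) μbits)) =
      [xor ((pred (boolPair P (xsbits ++ unitFlipFn (boolPair (boolPair (ones k) (ones c))
          (seedSumFn (seedCtx k kk sdbits μbits)))))).headD false)
        ((HashBricks.andParityFn (boolPair σbits μbits)).headD false)] := by
  rw [voteFn, HashBricks.xorFn_apply (b := (pred (boolPair P (xsbits ++ unitFlipFn (boolPair (boolPair (ones k) (ones c))
      (seedSumFn (seedCtx k kk sdbits μbits)))))).headD false)
    (b' := (HashBricks.andParityFn (boolPair σbits μbits)).headD false)]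
  · simp [vG, vDims, glRec, seedCtx, nthF]
  · simp [vG, glRec, HashBricks.andParityFn_boolPair]

/-- The piece of the count fold on `⟨⟨⟨G, xs⟩, 1ᶜ⟩, 1ʲ⟩`: `ε` (zero) for `j = 0`, else the vote for the
subset `T_j` (mask = low `kk` bits of `j`) as a one-bit numeral. [folklore] -/
noncomputable def countPiece (pred : List Bool → List Bool) : List Bool → List Bool :=
  iteFn (isNilFn ∘ sndF) (fun _ => [])
    (voteFn pred ∘ fanoutFn (fstF ∘ fstF) (fanoutFn (sndF ∘ fstF)
      (bitsOfFn ∘ fanoutFn (nthF 2 ∘ fstF ∘ sndF ∘ fstF ∘ fstF ∘ fstF) sndF)))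

/-- `countPiece pred ∈ FP`. [folklore] -/
theorem countPiece_mem_FP {pred : List Bool → List Bool} (hp : pred ∈ FP) : countPiece pred ∈ FP :=
  iteFn_mem_FP (comp_mem_FP isNilFn_mem_FP sndF_mem_FP) (const_mem_FP _)
    (comp_mem_FP (voteFn_mem_FP hp) (fanoutFn_mem_FP (comp_mem_FP fstF_mem_FP fstF_mem_FP)
      (fanoutFn_mem_FP (comp_mem_FP sndF_mem_FP fstF_mem_FP)
        (comp_mem_FP bitsOfFn_mem_FP (fanoutFn_mem_FP
          (comp_mem_FP (nthF_mem_FP 2) (comp_mem_FP fstF_mem_FP (comp_mem_FP sndF_mem_FP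
            (comp_mem_FP fstF_mem_FP (comp_mem_FP fstF_mem_FP fstF_mem_FP))))) sndF_mem_FP)))))

/-- Value of `countPiece`. [folklore] -/
theorem countPiece_apply (pred : List Bool → List Bool) (P : List Bool) (n k kk : ℕ) (sdbits σbits xsbits : List Bool) (c j : ℕ) :
    countPiece pred (boolPair (boolPair (boolPair (glRec P n k kk sdbits σbits) xsbits) (ones c)) (ones j)) =
      if j = 0 then [] else voteFn pred (boolPair (boolPair (glRec P n k kk sdbits σbits) xsbits)
        (boolPair (ones c) (List.ofFn fun r : Fin kk => j.testBit r))) := by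
  rw [countPiece, iteFn_apply (b := decide (j = 0)) (by simp [isNilFn, ones, List.replicate_eq_nil_iff])]
  by_cases hj : j = 0
  · simp [hj]
  · rw [decide_eq_false hj]
    simp only [Bool.false_eq_true, ite_false, if_neg hj, Function.comp_apply, fanoutFn_apply, fstF_boolPair, sndF_boolPair]
    have : nthF 2 (fstF (sndF (glRec P n k kk sdbits σbits))) = ones kk := by simp [glRec, nthF]
    rw [this, bitsOfFn_apply]

/-- The count pieces are at most one bit. [folklore] -/
theorem length_countPiece_le (pred : List Bool → List Bool) (w : List Bool) : (countPiece pred w).length ≤ 1 := by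
  rw [countPiece, iteFn_of_oneBit (oneBit_isNilFn.comp _)]
  split_ifs
  · simp
  · rw [Function.comp_apply, (oneBit_voteFn pred).length_eq]

/-- **The count** of nonempty subsets `T` voting `1`, on `⟨⟨G, xs⟩, 1ᶜ⟩` (a sum fold over `j < 2^kk`).
[cite: AroraBarakCC2009, Thm. 9.12 (proof: majority over the `2^k - 1` subsets)] -/
noncomputable def countFn (pred : List Bool → List Bool) : List Bool → List Bool :=
  sndPow 2 ∘ foldLoop addFn (clipF 1 (countPiece pred)) X ∘
    fanoutFn id (fanoutFn (lenBinF ∘ sndPow 2 ∘ fstF ∘ sndF ∘ fstF ∘ fstF) (fun _ => boolPair [] []))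

/-- `countFn pred ∈ FP`. [folklore] -/
theorem countFn_mem_FP {pred : List Bool → List Bool} (hp : pred ∈ FP) : countFn pred ∈ FP :=
  comp_mem_FP (sndPow_mem_FP 2) (comp_mem_FP
    (foldLoop_clipF_mem_FP 1 addFn_mem_FP length_addFn_le (countPiece_mem_FP hp) X)
    (fanoutFn_mem_FP (PolyTimeComputable.id _)
      (fanoutFn_mem_FP (comp_mem_FP lenBinF_mem_FP (comp_mem_FP (sndPow_mem_FP 2) (comp_mem_FP fstF_mem_FP
        (comp_mem_FP sndF_mem_FP (comp_mem_FP fstF_mem_FP fstF_mem_FP))))) (const_mem_FP _))))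

/-- **Value of `countFn`**: the number of `j ∈ [1, 2^kk)` whose subset votes `1`. [folklore] -/
theorem countFn_apply (pred : List Bool → List Bool) (P : List Bool) (n k kk : ℕ) (sdbits σbits xsbits : List Bool) (c : ℕ) :
    countFn pred (boolPair (boolPair (glRec P n k kk sdbits σbits) xsbits) (ones c)) =
      encodeNat (∑ j ∈ Finset.range (2 ^ kk), if j = 0 then 0 else
        bitsToNat (voteFn pred (boolPair (boolPair (glRec P n k kk sdbits σbits) xsbits)
          (boolPair (ones c) (List.ofFn fun r : Fin kk => j.testBit r))))) := by
  have hK : 2 ^ kk ≤ X.eval (boolPair (boolPair (glRec P n k kk sdbits σbits) xsbits) (ones c)).length := by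
    rw [eval_X]; simp only [length_boolPair, glRec, ones, List.length_replicate]; omega
  have h1 : lenBinF (sndPow 2 (fstF (sndF (fstF (fstF (boolPair (boolPair (glRec P n k kk sdbits σbits) xsbits) (ones c))))))) =
      encodeNat (2 ^ kk) := by simp [glRec, sndPow, ones]
  rw [countFn, Function.comp_apply, Function.comp_apply, fanoutFn_apply, fanoutFn_apply, id,
    Function.comp_apply, Function.comp_apply, Function.comp_apply, Function.comp_apply, Function.comp_apply, h1,
    show (boolPair ([] : List Bool) []) = boolPair (ones 0) (encodeNat 0) by rfl,
    foldLoop_apply _ _ hK, foldAcc_clipF (fun j _ _ => (length_countPiece_le pred _).trans (by omega)), foldAcc_addFn]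
  simp only [sndPow, Function.comp_apply, sndF_boolPair, zero_add, countPiece_apply]
  congr 1
  refine Finset.sum_congr rfl fun j _ => ?_
  split_ifs <;> simp

/-- **The candidate bit** `[2^kk - 1 < 2·count]` on `⟨⟨G, xs⟩, 1ᶜ⟩` (Rackoff's majority).
[cite: AroraBarakCC2009, Thm. 9.12 (proof, Algorithm B′)] -/
noncomputable def candBitFn (pred : List Bool → List Bool) : List Bool → List Bool :=
  ltFn ∘ fanoutFn (nthF 2 ∘ fstF ∘ sndF ∘ fstF ∘ fstF) (addFn ∘ fanoutFn (countFn pred) (countFn pred))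

/-- `candBitFn pred ∈ FP`. [folklore] -/
theorem candBitFn_mem_FP {pred : List Bool → List Bool} (hp : pred ∈ FP) : candBitFn pred ∈ FP :=
  comp_mem_FP ltFn_mem_FP (fanoutFn_mem_FP
    (comp_mem_FP (nthF_mem_FP 2) (comp_mem_FP fstF_mem_FP (comp_mem_FP sndF_mem_FP (comp_mem_FP fstF_mem_FP fstF_mem_FP))))
    (comp_mem_FP addFn_mem_FP (fanoutFn_mem_FP (countFn_mem_FP hp) (countFn_mem_FP hp))))

/-- `candBitFn pred` is one-bit. [folklore] -/
theorem oneBit_candBitFn (pred : List Bool → List Bool) : OneBit (candBitFn pred) := fun w => by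
  rw [candBitFn, Function.comp_apply, fanoutFn_apply, ltFn_boolPair]; exact ⟨_, rfl⟩

/-- Value of `candBitFn`. [folklore] -/
theorem candBitFn_apply (pred : List Bool → List Bool) (P : List Bool) (n k kk : ℕ) (sdbits σbits xsbits : List Bool) (c : ℕ) :
    candBitFn pred (boolPair (boolPair (glRec P n k kk sdbits σbits) xsbits) (ones c)) =
      [decide (2 ^ kk - 1 < 2 * bitsToNat (countFn pred (boolPair (boolPair (glRec P n k kk sdbits σbits) xsbits) (ones c))))] := by
  rw [candBitFn, Function.comp_apply, fanoutFn_apply, ltFn_boolPair]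
  simp only [Function.comp_apply, fanoutFn_apply, fstF_boolPair, addFn_boolPair, bitsToNat_encodeNat]
  have : nthF 2 (fstF (sndF (glRec P n k kk sdbits σbits))) = ones kk := by simp [glRec, nthF]
  rw [this, bitsToNat_ones, two_mul]

/-- **The candidate vector** on `⟨G, xs⟩`: the `k` candidate bits (a concatenation fold).
[cite: AroraBarakCC2009, Thm. 9.12 (proof, Algorithm B′)] -/
noncomputable def candVecFn (pred : List Bool → List Bool) : List Bool → List Bool :=
  sndPow 2 ∘ foldLoop appF (clipF 1 (candBitFn pred)) X ∘
    fanoutFn id (fanoutFn (lenBinF ∘ nthF 1 ∘ fstF ∘ sndF ∘ fstF) (fun _ => boolPair [] []))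

/-- **`candVecFn pred ∈ FP`** for `pred ∈ FP`. [cite: AroraBarakCC2009, §1.3] -/
theorem candVecFn_mem_FP {pred : List Bool → List Bool} (hp : pred ∈ FP) : candVecFn pred ∈ FP :=
  comp_mem_FP (sndPow_mem_FP 2) (comp_mem_FP
    (foldLoop_clipF_mem_FP 1 appF_mem_FP length_appF_le (candBitFn_mem_FP hp) X)
    (fanoutFn_mem_FP (PolyTimeComputable.id _)
      (fanoutFn_mem_FP (comp_mem_FP lenBinF_mem_FP (comp_mem_FP (nthF_mem_FP 1) (comp_mem_FP fstF_mem_FP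
        (comp_mem_FP sndF_mem_FP fstF_mem_FP)))) (const_mem_FP _))))

/-- Value of `candVecFn` (string level): the concatenation of the candidate bits. [folklore] -/
theorem candVecFn_apply_str (pred : List Bool → List Bool) (P : List Bool) (n k kk : ℕ) (sdbits σbits xsbits : List Bool) :
    candVecFn pred (boolPair (glRec P n k kk sdbits σbits) xsbits) =
      ccat (fun c => candBitFn pred (boolPair (boolPair (glRec P n k kk sdbits σbits) xsbits) (ones c))) k := by
  have hk : k ≤ X.eval (boolPair (glRec P n k kk sdbits σbits) xsbits).length := by
    rw [eval_X]; simp only [length_boolPair, glRec]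
    have : (ones k).length = k := by simp [ones]
    omega
  have h1 : lenBinF (nthF 1 (fstF (sndF (fstF (boolPair (glRec P n k kk sdbits σbits) xsbits))))) = encodeNat k := by
    simp [glRec, nthF, ones]
  rw [candVecFn, Function.comp_apply, Function.comp_apply, fanoutFn_apply, fanoutFn_apply, id,
    Function.comp_apply, Function.comp_apply, Function.comp_apply, Function.comp_apply, h1,
    show (boolPair ([] : List Bool) []) = boolPair (ones 0) ([] : List Bool) by rfl,
    foldLoop_apply _ _ hk, foldAcc_clipF (fun j _ _ => by rw [(oneBit_candBitFn pred).length_eq]; omega), foldAcc_appF]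
  simp [sndPow]

/-! ### Bridge to `glStage` -/

section Bridge

variable {n k kk : ℕ}

/-- The tuple `x⃗` as `kn` bits (block `c` = `x⃗_c`). [folklore] -/
def tupleBits (xs : Fin k → (Fin n → Bool)) : List Bool :=
  List.ofFn fun p : Fin (k * n) => xs (finProdFinEquiv.symm p).1 (finProdFinEquiv.symm p).2

omit kk in
/-- The `AMP` input assembled from `(x⃗, r)` is `tupleBits x⃗` followed by the bits of `r`. [folklore] -/
theorem ofFn_ampInput (xs : Fin k → (Fin n → Bool)) (r : BVec k) :
    List.ofFn (((ampEquiv n k).symm (xs, r)) ∘ (ampIdxEquiv n k).symm) =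
      tupleBits xs ++ List.ofFn fun c : Fin k => zmodToBool (r c) := by
  apply List.ext_getElem
  · simp [tupleBits]
  · intro idx h1 h2
    rw [List.getElem_ofFn, List.getElem_append]
    simp only [tupleBits, List.length_ofFn, Function.comp_apply]
    rw [List.length_ofFn] at h1
    split_ifs with h
    · rw [List.getElem_ofFn]
      have hidx : (⟨idx, h1⟩ : Fin (k * n + k)) = ampIdxEquiv n k (Sum.inl (finProdFinEquiv.symm ⟨idx, h⟩)) := by
        apply Fin.ext
        rw [ampIdxEquiv_inl_val]
        have := finProdFinEquiv.apply_symm_apply (⟨idx, h⟩ : Fin (k * n))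
        have hv := congrArg Fin.val this
        rw [finProdFinEquiv_apply_val] at hv
        dsimp only at hv ⊢
        linarith [Nat.mul_comm n ((finProdFinEquiv.symm ⟨idx, h⟩).1 : ℕ)]
      rw [hidx, Equiv.symm_apply_apply]
      rfl
    · rw [List.getElem_ofFn]
      rw [not_lt] at h
      have hidx : (⟨idx, h1⟩ : Fin (k * n + k)) = ampIdxEquiv n k (Sum.inr ⟨idx - k * n, by omega⟩) := by
        apply Fin.ext; rw [ampIdxEquiv_inr_val]; dsimp only; omega
      rw [hidx, Equiv.symm_apply_apply]
      simp [ampEquiv]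

/-- `𝔽₂`-valued guesses read as bits and back. [folklore] -/
theorem sum_filter_eq_card_and (σ : Fin kk → ZMod 2) (μ : Fin kk → Bool) :
    ∑ t ∈ univ.filter (fun t => μ t = true), σ t =
      ((univ.filter fun t : Fin kk => (zmodToBool (σ t) && μ t) = true).card : ZMod 2) := by
  rw [Finset.sum_filter, ← Finset.sum_boole]
  refine Finset.sum_congr rfl fun t _ => ?_
  have hσ : σ t = boolToZMod (zmodToBool (σ t)) := (boolToZMod_zmodToBool _).symm
  rw [hσ]
  cases zmodToBool (σ t) <;> cases μ t <;> simp [boolToZMod, zmodToBool]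

omit n k in
/-- The guess parity `Σ_{t ∈ T} σ_t` as a bit is the `andParity` of the guess bits with the mask. [folklore] -/
theorem zmodToBool_sum_filter (σ : Fin kk → ZMod 2) (μ : Fin kk → Bool) :
    zmodToBool (∑ t ∈ univ.filter (fun t => μ t = true), σ t) =
      (HashBricks.andParityFn (boolPair (List.ofFn fun t => zmodToBool (σ t)) (List.ofFn μ))).headD false := by
  rw [sum_filter_eq_card_and, HashBricks.andParityFn_boolPair, zipWith_ofFn, count_true_ofFn, List.headD_cons, zmodToBool]
  exact decide_eq_decide.2 ZMod.natCast_eq_one_iff_odd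

/-- The bits of `r_T + e_c`. [folklore] -/
theorem ofFn_seedSum_add_single (sd : Fin kk → BVec k) (μ : Fin kk → Bool) (c : Fin k) :
    (List.ofFn fun p : Fin k => xor (zmodToBool (∑ t : Fin kk, if μ t = true then sd t p else 0)) (decide ((p : ℕ) = c))) =
      List.ofFn fun p : Fin k => zmodToBool ((seedSum sd (univ.filter fun t => μ t = true) + Pi.single c 1 : BVec k) p) := by
  refine congrArg List.ofFn (funext fun p => ?_)
  rw [Pi.add_apply, zmodToBool_add, seedSum, Finset.sum_apply, Finset.sum_filter, Pi.single_apply]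
  congr 1
  by_cases hp : p = c
  · subst hp; simp [zmodToBool]
  · have : (p : ℕ) ≠ c := fun h => hp (Fin.ext h)
    simp [hp, this, zmodToBool]

variable (h₁ : (Fin (k * n + k) → Bool) → Bool) {pred : List Bool → List Bool} {P : List Bool}

/-- **The machine vote is Rackoff's vote**: for the mask `μ` (subset `T = {t | μ t}`) and coordinate `c`,
the vote bit is `zmodToBool (glVote B sd σ T c)` with `B(r) = glOracle h₁ (x⃗, r)`.
[cite: AroraBarakCC2009, Thm. 9.12 (proof, Algorithm B′)] -/
theorem voteFn_eq_glVote (hP : ∀ u : Fin (k * n + k) → Bool, pred (boolPair P (List.ofFn u)) = [h₁ u])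
    (sd : Fin kk → BVec k) (σ : Fin kk → ZMod 2) (xs : Fin k → (Fin n → Bool)) (c : Fin k) (μ : Fin kk → Bool) :
    voteFn pred (boolPair (boolPair (glRec P n k kk (seedBits sd) (List.ofFn fun t => zmodToBool (σ t))) (tupleBits xs))
      (boolPair (ones c) (List.ofFn μ))) =
      [zmodToBool (glVote (fun r => glOracle h₁ (xs, r)) sd σ (univ.filter fun t => μ t = true) c)] := by
  rw [voteFn_apply, seedSumFn_apply, unitFlipFn_apply c.isLt, ofFn_seedSum_add_single, ← ofFn_ampInput, hP,
    List.headD_cons, glVote, zmodToBool_add, ← zmodToBool_sum_filter, glOracle, zmodToBool_boolToZMod, Bool.xor_comm]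

/-- The subset coded by `j < 2^kk`: `T_j = {t | bit t of j}`, through the standard enumeration and
`posSetEquiv`. [folklore] -/
theorem posSetEquiv_symm_boolFunEquivFin (j : Fin (2 ^ kk)) :
    ((boolFunEquivFin kk).symm.trans (DirectProduct.posSetEquiv kk)) j = univ.filter fun t : Fin kk => (j : ℕ).testBit t = true := by
  open MCSPVerif in
  simp only [Equiv.trans_apply, DirectProduct.posSetEquiv, DirectProduct.posSet, boolFunEquivFin_symm_apply, Equiv.coe_fn_mk]
  refine Finset.filter_congr fun t _ => ?_
  rw [lowBits_apply]

omit n k in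
/-- `j = 0` iff its subset is empty (`j < 2^kk`). [folklore] -/
theorem filter_testBit_eq_empty_iff (j : Fin (2 ^ kk)) :
    (univ.filter fun t : Fin kk => (j : ℕ).testBit t = true) = ∅ ↔ (j : ℕ) = 0 := by
  constructor
  · intro h
    apply Nat.eq_of_testBit_eq
    intro t
    rw [Nat.zero_testBit]
    by_cases ht : t < kk
    · have : (⟨t, ht⟩ : Fin kk) ∉ univ.filter fun t : Fin kk => (j : ℕ).testBit t = true := by rw [h]; simp
      simpa using this
    · exact Nat.testBit_lt_two_pow (lt_of_lt_of_le j.isLt (Nat.pow_le_pow_right (by norm_num) (not_lt.1 ht)))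
  · intro h
    rw [h]
    ext t; simp

/-- **The machine count is the number of nonempty subsets voting `1`.**
[cite: AroraBarakCC2009, Thm. 9.12 (proof, Algorithm B′)] -/
theorem bitsToNat_countFn_eq (hP : ∀ u : Fin (k * n + k) → Bool, pred (boolPair P (List.ofFn u)) = [h₁ u])
    (sd : Fin kk → BVec k) (σ : Fin kk → ZMod 2) (xs : Fin k → (Fin n → Bool)) (c : Fin k) :
    bitsToNat (countFn pred (boolPair (boolPair (glRec P n k kk (seedBits sd) (List.ofFn fun t => zmodToBool (σ t)))
      (tupleBits xs)) (ones c))) =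
      ((nonemptySubsets kk).filter fun T => glVote (fun r => glOracle h₁ (xs, r)) sd σ T c = 1).card := by
  classical
  rw [countFn_apply, bitsToNat_encodeNat]
  have hvote : ∀ j : ℕ, bitsToNat (voteFn pred (boolPair (boolPair (glRec P n k kk (seedBits sd)
      (List.ofFn fun t => zmodToBool (σ t))) (tupleBits xs)) (boolPair (ones c) (List.ofFn fun r : Fin kk => j.testBit r)))) =
      if glVote (fun r => glOracle h₁ (xs, r)) sd σ (univ.filter fun t : Fin kk => j.testBit t = true) c = 1 then 1 else 0 := by
    intro j
    rw [voteFn_eq_glVote h₁ hP]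
    unfold zmodToBool
    by_cases h : glVote (fun r => glOracle h₁ (xs, r)) sd σ (univ.filter fun t : Fin kk => j.testBit t = true) c = 1 <;>
      simp [h]
  simp only [hvote]
  -- reindex `range (2^kk)` by the subsets
  rw [← Fin.sum_univ_eq_sum_range (fun j => if j = 0 then 0 else
      if glVote (fun r => glOracle h₁ (xs, r)) sd σ (univ.filter fun t : Fin kk => j.testBit t = true) c = 1 then 1 else 0) (2 ^ kk),
    ← Equiv.sum_comp ((boolFunEquivFin kk).symm.trans (DirectProduct.posSetEquiv kk)).symm, Finset.card_eq_sum_ones,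
    Finset.sum_filter, nonemptySubsets, Finset.sum_filter]
  refine Finset.sum_congr rfl fun T _ => ?_
  set j := ((boolFunEquivFin kk).symm.trans (DirectProduct.posSetEquiv kk)).symm T with hj
  have hT : univ.filter (fun t : Fin kk => (j : ℕ).testBit t = true) = T := by
    rw [← posSetEquiv_symm_boolFunEquivFin, hj, Equiv.apply_symm_apply]
  rw [hT]
  by_cases h0 : (j : ℕ) = 0
  · have hTe : T = ∅ := by rw [← hT]; exact (filter_testBit_eq_empty_iff j).2 h0
    simp [h0, hTe]
  · have hTn : T.Nonempty := by
      rw [Finset.nonempty_iff_ne_empty, ← hT]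
      exact fun h => h0 ((filter_testBit_eq_empty_iff j).1 h)
    simp [h0, hTn]

/-- **The GL stage of the machine is `glStage`**: on the GL record of the seeds `sd`, guesses `σ` and
the tuple `x⃗`, with a predictor `pred` realising `h₁`, `candVecFn pred` returns the bits of
Rackoff's candidate, i.e. `List.ofFn (glStage h₁ (sd, σ) x⃗)`.
[cite: CarmosinoImpagliazzoKabanetsKolokolova2016, §5 (complete algorithm, step 4)] -/
theorem candVecFn_apply (hP : ∀ u : Fin (k * n + k) → Bool, pred (boolPair P (List.ofFn u)) = [h₁ u])
    (sd : Fin kk → BVec k) (σ : Fin kk → ZMod 2) (xs : Fin k → (Fin n → Bool)) :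
    candVecFn pred (boolPair (glRec P n k kk (seedBits sd) (List.ofFn fun t => zmodToBool (σ t))) (tupleBits xs)) =
      List.ofFn (glStage h₁ (sd, σ) xs) := by
  rw [candVecFn_apply_str, ccat_congr (g' := fun c => [if h : c < k then glStage h₁ (sd, σ) xs ⟨c, h⟩ else false])
    (fun c hc => by
      rw [dif_pos hc, candBitFn_apply, bitsToNat_countFn_eq h₁ hP sd σ xs ⟨c, hc⟩]
      simp only [glStage, glCandidate, card_nonemptySubsets, zmodToBool]
      split_ifs <;> simp_all),
    ccat_singleton_eq_ofFn]
  exact congrArg List.ofFn (funext fun c => by rw [dif_pos c.isLt])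

end Bridge

end Literature.Computability.Learning
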